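import Literature.MathematicalPhysics.QuantumFieldTheory.Balaban1983to89.B2Eq265PrintedRemainder

/-!
# `Balaban1983to89.B2Eq265AsPrinted` — [Balaban1982Higgs2] Lemma 2.4 (2.65) p.572 IN PRINT'S LITERAL SHAPE on the (Higgs)₂,₃ carrier of
# record: «φ^{(k)}(x) = U(A^{(k)}(Γ^{(k)}_{x,y}))φ(y) + O(p(Lᵏε))» — ONE constant times `p(s)`, `s ⇐ Lᵏε`, from F21 `B2Eq265PrintedRemainder`
# at the printed instance `β = 1` with the three groups absorbed (`eq265_higgs_region_asPrinted`, `eq265_higgs_tower_asPrinted`)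

statement-level skeleton of published theorems with citation tags; proofs where landed; nothing here is a claim
about the Yang–Mills mass gap

PDF held: `paper:balaban1982-cmp86-higgs23-ii` (journal page = PDF page + 554), p. 572 [PDF 18] (Lemma 2.4 «Under the restrictions (2.55) we
have φ^{(k)}(x) = U(A^{(k)}(Γ^{(k)}_{x,y}))φ(y) + O(p(Lᵏε)) for x ∈ Bᵏ(y), y ∈ Λ₂^{(k−1)′} (2.65)»; (2.68) «+ O((Lᵏε)^{κ₀}), κ₀ > 0»), p. 573 [PDF 19]
(«Combining the equalities (2.67), (2.68), (2.74), (2.76) … we finally get (2.65)»), p. 557 [PDF 3] ((2.2) «p(ε) = b₀(1 + log ε⁻¹)ᵖ, p > 2»; (2.5)).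

CITATION HEADER (lean-in-tree rule).  T. Bałaban, *(Higgs)₂,₃ quantum fields in a finite volume. II. An upper bound*,
Commun. Math. Phys. **86** (1982) 555–594, doi:10.1007/bf01214890 [Balaban1982Higgs2].  Cell `lit-balaban` (HOME
`run/shared/lean/pub/lit-balaban/`), Phase-2 proof seat **p23** gen 24 (unit `lit-balaban-p23-g24`; free-target protocol G.5-34(d), TAKING #2
line HOME/STATUS.md 2026-08-23); SKELETON row **B2.Lem2.4** (fold owner r02, second reader r14; head `proved p250408 · …` UNCHANGED — cells-only
member, brick F22 = the bookkeeping corollary named in r02 g49's Q-p23g23-2 ruling «O(p(Lᵏε)) absorbs s^{κ₀} ≤ 1 ≤ p(s)/b₀ only as print's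
bookkeeping»).  USED BY NAME, never restated: own F21 `B2Eq265PrintedRemainder.eq265_higgs_region_remainder` / `eq265_higgs_tower_remainder`,
F21a `B2Eq265Dictionary.printed_exponents`; b2b's `B1.aSeq_le`, `B2.pFn`.

THE ARGUMENT.  F21 gives `‖…‖ ≤ C′a_k s^κ + C″p(s) + C‴s^{κ₀}` for EVERY real `κ` (the binder `(κ : ℝ)` of F18a–F21 carries no
condition: the (2.67)/(2.76) exponential tails are `O(s^κ)` for arbitrary `κ`, (2.109)) and every `κ₀` meeting F21's two exponent conditions
`κ₀ + (4−d)/4 < β(4−d)/2`, `κ₀ + (4−d)/4 < 2`; at print's instance `β = 1` these reduce to `κ₀ < (4−d)/4` (F21a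
`B2Eq265Dictionary.printed_exponents`), which `κ₀ := 0` meets exactly when `d ≤ 3` (`0 < (4−d)/4`).  So take `β := 1`, `κ := 0`, `κ₀ := 0`;
then `a_k·s⁰ = a_k ≤ a` ([Balaban1982Higgs1] (2.15), b2b's `B1.aSeq_le`) and `s⁰ = 1 ≤ p(s)/b₀` (`p(s) = b₀(1 + log s⁻¹)ᵖ ≥ b₀` on `(0,1]`,
`b₀ > 0` from `Q.Printed`), so the three groups are `≤ (C′a/b₀ + C″ + C‴/b₀)·p(s)`.

WHAT THIS FILE PROVES (kernel-checked, zero `sorry`; theorems only — NO definition, NO `Prop`-valued fact; axioms standard).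
 **`le_pFn`** — `b₀ ≤ p(s)` on `(0, 1]`; **`absorb_three_groups`** — `C′a_k s⁰ + C″p(s) + C‴s⁰ ≤ (C′a/b₀ + C″ + C‴/b₀)·p(s)` for `a_k ≤ a`.
 **`eq265_higgs_region_asPrinted`** — F21's `eq265_higgs_region_remainder` telescope word for word except (located edits): `(c_reg : ℝ)
 (hcreg : 0 ≤ c_reg)` without `β`; no `κ`, `κ₀` binders and no exponent conditions; the vestigial constant block `∃ C₁ C₂ C₃ D₁ … D₄ … ∃ C′ …
 ∃ E₁ E₂ E₃ … ∃ C″ C‴ …` replaced by `∃ C : ℝ, 0 ≤ C ∧`; `≤ c_reg·e_c` in the charge hypothesis; conclusion `≤ C·p(s)` (`p(s) = B2.pFn Q.b₀ Q.p s`).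
 **`eq265_higgs_tower_asPrinted`** — the same over F21's `eq265_higgs_tower_remainder` (print's own tower regions, cube size `M`, level `j + 1`).

HONEST SCOPE / DIFFERENCES FROM PRINT (recorded, not hidden).  (a) Pure bookkeeping over F21: `κ = κ₀ = 0` is the weakest admissible choice
(the RATES of the (2.67)/(2.68)/(2.76) tails live in F21/F18a, not here); `C = C′a/b₀ + C″ + C‴/b₀` (uses `b₀ > 0` of `Q.Printed` and
`a_k ≤ a`) depends on everything F21's constants depend on (`d, L, a, λ, c₁, b₀, p, R, r, c_reg, ē, θ₃, m₁` and `K₀`/`M`, `C₃, E₁, E₂, E₃`).  (b) Everything else exactly as F21's HONEST SCOPE: the (2.5)/(2.7)/(2.1) dictionary as three hypotheses on the free letters `ē, θ₃,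
m₁`; `β = 1`; `d ≤ 3`; `h1`; `ℓ′ = s/L`; `c₁, λ` in front; `μ₀` free; `θ₁, θ₂` read; the two charge-smallness hypotheses («e(ε) sufficiently
small») stay hypotheses; `Q_k^*(A^{(k)})`-form of the transport as in F5–F21; nothing minted.  NOT summit progress.
-/

open scoped BigOperators

noncomputable section

namespace Literature.MathematicalPhysics.QuantumFieldTheory.Balaban1983to89.B2Eq265AsPrinted

open HiggsLattice (ChargeData)
open HiggsAveraging (blockIter toFinest)
open HiggsCovariance (avgQkAdj)
open B2Eq255Concrete (bgScalar256 underRegion mem_underRegion Restr255 Restr255Printed)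
open B2Eq265PrintedRemainder (eq265_higgs_region_remainder eq265_higgs_tower_remainder)
open B2Eq265Dictionary (printed_exponents)
open B2Eq324NestedRegions (prime)
open B2Eq243RegionsTower (towerRegion)
open B2Eq28RegionsConcrete (near)
open B2Lemma23HiggsLattice (cutMin)
open B1Eq211ZeroFieldTorus (Shape)
open B3MultiscaleFields (toSite ofSite)
open B1Ineq225RegularBox (cellBox)
open B1TorusRegionHSizes (IsBigBlockUnion)
open B1TorusCubeCover (half)
open B1TorusCubeLocality26 (rS)

variable {P : HiggsLattice.Params} {k : ℕ}

/-- `p(s) ≥ b₀` on `(0, 1]` for `b₀ ≥ 0`, `p ≥ 0` (`1 + log s⁻¹ ≥ 1`): the absorption `1 ≤ p(s)/b₀` of print's bookkeeping.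
[cite: Balaban1982Higgs2, (2.2) p.557 «p(ε) = b₀(1 + log ε⁻¹)ᵖ»] -/
theorem le_pFn {b₀ p s : ℝ} (hb : 0 ≤ b₀) (hp : 0 ≤ p) (hs : 0 < s) (hs1 : s ≤ 1) : b₀ ≤ B2.pFn b₀ p s := by
  unfold B2.pFn
  have hu : 1 ≤ 1 + Real.log s⁻¹ := by linarith [Real.log_nonneg ((one_le_inv₀ hs).2 hs1)]
  have h1 : (1 : ℝ) ≤ (1 + Real.log s⁻¹) ^ p := Real.one_le_rpow hu hp
  nlinarith

/-- the three groups of F21 absorbed into print's single symbol: `C′a_k·s⁰ + C″p(s) + C‴s⁰ ≤ (C′a/b₀ + C″ + C‴/b₀)·p(s)` for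
`a_k ≤ a`, `a, C′, C‴ ≥ 0`, `b₀ > 0`, `p ≥ 0`, `s ∈ (0, 1]`. [cite: Balaban1982Higgs2, Lemma 2.4 (2.65) p.572 «+ O(p(Lᵏε))», (2.2) p.557] -/
theorem absorb_three_groups {C' C'' C''' a ak b₀ p s : ℝ} (hC' : 0 ≤ C') (hC''' : 0 ≤ C''') (ha : 0 ≤ a) (hak : ak ≤ a)
    (hb : 0 < b₀) (hp : 0 ≤ p) (hs : 0 < s) (hs1 : s ≤ 1) :
    C' * ak * s ^ (0 : ℝ) + C'' * B2.pFn b₀ p s + C''' * s ^ (0 : ℝ) ≤ (C' * a / b₀ + C'' + C''' / b₀) * B2.pFn b₀ p s := by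
  have hp1 := le_pFn hb.le hp hs hs1
  simp only [Real.rpow_zero, mul_one]
  have h1 : C' * ak ≤ C' * a / b₀ * B2.pFn b₀ p s :=
    calc C' * ak ≤ C' * a := mul_le_mul_of_nonneg_left hak hC'
      _ = C' * a / b₀ * b₀ := by field_simp
      _ ≤ C' * a / b₀ * B2.pFn b₀ p s := mul_le_mul_of_nonneg_left hp1 (div_nonneg (mul_nonneg hC' ha) hb.le)
  have h2 : C''' ≤ C''' / b₀ * B2.pFn b₀ p s :=
    calc C''' = C''' / b₀ * b₀ := by field_simp
      _ ≤ C''' / b₀ * B2.pFn b₀ p s := mul_le_mul_of_nonneg_left hp1 (div_nonneg hC''' hb.le)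
  have h3 : (C' * a / b₀ + C'' + C''' / b₀) * B2.pFn b₀ p s
      = C' * a / b₀ * B2.pFn b₀ p s + C'' * B2.pFn b₀ p s + C''' / b₀ * B2.pFn b₀ p s := by ring
  rw [h3]
  linarith


/-! ## §1 General regions, cube size `K₀ ∣ M` -/

/-- **LEMMA 2.4 (2.65) IN PRINT'S LITERAL SHAPE, GENERAL REGIONS**: under the restrictions (2.55) (printed thresholds at `ℓ′ = s/L`) and the
(2.5)/(2.7)/(2.1) dictionary hypotheses, `‖φ^{(k)}(x) − (Q_k^*(A^{(k)})φ)(x)‖ ≤ C·p(s)`, ONE constant chosen before `∀ P, s`.  TYPED vs PRINTED: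
own F21 `B2Eq265PrintedRemainder.eq265_higgs_region_remainder` at `β := 1`, `κ := 0`, `κ₀ := 0` with the located edits of the header.
[cite: Balaban1982Higgs2, Lemma 2.4 (2.65) p.572 «φ^{(k)}(x) = U(A^{(k)}(Γ^{(k)}_{x,y}))φ(y) + O(p(Lᵏε)) for x ∈ Bᵏ(y), y ∈ Λ₂^{(k−1)′}»; proof pp.572–573; (2.2)/(2.5) p.557, (2.7) p.558, (2.55)–(2.56) p.570, (2.60) p.571]
[cite: Balaban1982Higgs1, (2.15) p.609] -/
theorem eq265_higgs_region_asPrinted (d L : ℕ) (hd : 1 ≤ d) (hd3 : d ≤ 3) (hL : Odd L ∧ 1 < L) {a : ℝ} (ha : 0 < a) {msq : ℝ} (hmsq : 0 < msq)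
    {aV : ℝ} (haV : 0 < aV) {mu0sq : ℝ} (hmu0 : 0 < mu0sq)
    (N : ℕ) (C : ChargeData N) (ε₀ : ℝ) (creg : ℝ) (hcreg : 0 ≤ creg)
    (Q : B2.Params) (hQ : Q.Printed) {c₁ lam : ℝ} (hc₁ : 0 ≤ c₁) (hlam : 0 < lam) {θ₁ θ₂ : ℝ} (hθ₁ : 0 < θ₁) (hθ₂ : 0 < θ₂)
    {ebar θ₃ m₁ : ℝ} (hebar : 0 ≤ ebar) (hθ₃ : 0 ≤ θ₃) :
    ∃ δ CV CF : ℝ, 0 < δ ∧ 0 < CV ∧ 0 < CF ∧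
    ∃ K₀min : ℕ, ∀ K₀ : ℕ, K₀min ≤ K₀ → ∃ e₁ t : ℝ, 0 < e₁ ∧ 0 < t ∧
      ∃ Cp : ℝ, 0 ≤ Cp ∧
      ∀ (P : HiggsLattice.Params) (_ : Shape P), P.d = d → P.L = L → K₀ ∣ P.M →
      ∀ {k : ℕ}, 1 ≤ k → k ≤ P.K → (∀ μ, 3 * half P k K₀ ≤ P.sitesPerDir 0 μ) → P.mesh k ≤ ε₀ → P.mesh k ≤ 1 →
      ∀ (Λ₂ Λ₆ sq₂ sq₁ : Finset (HiggsLattice.Site P k)) (S : Fin P.d → Finset ℕ) (q : HiggsLattice.Site P k) (Sbox : ℕ),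
        Λ₆ ⊆ Λ₂ → sq₂ ⊆ Λ₂ → sq₁ ⊆ Λ₆ →
        IsBigBlockUnion k K₀ (underRegion k Λ₂) → underRegion k sq₂ = cellBox k K₀ S →
        (∀ μ : Fin P.d, P.L ^ k * Sbox < P.sitesPerDir 0 μ) →
      -- `□₂` IS the box `q + [0,S)ᵈ` of coarse sites, `□ = B^k(□₂)` smaller than half the torus
        (∀ y : HiggsLattice.Site P k, y ∈ sq₂ ↔ ∀ ν : Fin P.d, (y ν - q ν).val < Sbox) →
        (∀ μ : Fin P.d, 2 * (P.L ^ k * Sbox) ≤ P.sitesPerDir 0 μ) →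
      -- `□₁` is the box of coarse sites of radius `R₁` (corner `q₁`); `m ≥ R₁` a coarse margin with `Lᵏm ≥` the depth radius
      ∀ (q₁ : HiggsLattice.Site P k) (R₁ m : ℕ), R₁ ≤ m → 2 * rS P k K₀ + 2 * half P k K₀ * (P.d + 1) + 1 ≤ P.L ^ k * m →
        (∀ y : HiggsLattice.Site P k, y ∈ sq₁ ↔ ∀ ν : Fin P.d, (y ν - q₁ ν).val < 2 * R₁ + 1) →
      -- the region `Λ₋₁` of (2.55); the cutoff `ζ^{(k)}` of (2.44); the cube of radius `R_n ≥ ρ + 1` about every `y ∈ Λ₂` inside `Λ₋₁` ((2.8))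
      ∀ (Λm1 : Finset (HiggsLattice.Site P k))
        (ζ : HiggsLattice.Site P 0 → HiggsLattice.Site P k → ℝ) (ρ ρ₁ : ℝ), 0 ≤ ρ₁ →
        (∀ x y', |ζ x y'| ≤ 1) →
        (∀ x y', ζ x y' ≠ 0 → (HiggsLattice.Site.tdist (blockIter k x) y' : ℝ) ≤ ρ) →
        (∀ x y', (HiggsLattice.Site.tdist (blockIter k x) y' : ℝ) ≤ ρ₁ → ζ x y' = 1) →
        (∀ (x : HiggsLattice.Site P 0) (ν : Fin P.d) (y' : HiggsLattice.Site P k), |ζ (x.shift ν) y' - ζ x y'| ≤ ((P.L : ℝ) ^ k)⁻¹) →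
      ∀ (Rn : ℕ), ρ + 1 ≤ (Rn : ℝ) → (∀ μ : Fin P.d, 2 * (2 * Rn + 1) ≤ P.sitesPerDir k μ) →
        (∀ y ∈ Λ₂, ∀ y' : HiggsLattice.Site P k, HiggsLattice.Site.tdist y y' ≤ Rn → y' ∈ Λm1) →
      -- a charge datum on `ℝ^d`, the step's vector field `A′`, and print's `μ₀` of the (2.55)₂ threshold
      ∀ (C₀ : ChargeData P.d) (A' : HiggsLattice.VecField P k) {μ₀ : ℝ}, 0 < μ₀ →
      -- THE PHYSICAL SCALE `s ⇐ Lᵏε` AS A FREE LETTER (F18a), the (2.55) letter `L^{k−1}ε ⇐ s/L`: radii readings `m ≥ θ₁r(s)`, `R₁ + 1 ≥ θ₂r(s)`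
      ∀ {s : ℝ}, 0 < s → s ≤ 1 →
        θ₁ * B2.rFn Q.R Q.r s ≤ (m : ℝ) → θ₂ * B2.rFn Q.R Q.r s ≤ (R₁ : ℝ) + 1 →
      -- THE DICTIONARY READ at `s ⇐ Lᵏε`: the side of `□₂` `S ≤ θ₃r(s)` (p.572, (2.7)), the mass term `m²ℓ² ≤ m₁²s²` ((2.1)); below: `e_c ≤ ē·s^{(4−d)/2}` ((2.5))
        (Sbox : ℝ) ≤ θ₃ * B2.rFn Q.R Q.r s → msq * P.mesh k ^ 2 ≤ m₁ ^ 2 * s ^ 2 →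
      -- `δ_A :=` THE (2.60) BOUND ITSELF (read off the printed (2.55)₁,₂ thresholds at `ℓ′ = s/L`), small in the two printed scalings: `Lᵏδ_A|e| ≤ t`, `Lᵏℓ|e|δ_A ≤ c_reg·e_c` (`β = 1`)
        (CV * P.d * (P.mesh k * (c₁ * B2.pFn Q.b₀ Q.p (s / (L : ℝ)))) + CF * Real.exp (-(δ * ρ₁)) * (c₁ * (1 / (μ₀ * (s / (L : ℝ)))) * B2.pFn Q.b₀ Q.p (s / (L : ℝ)))) * |C.e| ≤ t →
        ∀ {ec : ℝ}, 0 < ec → ec ≤ e₁ → ec ≤ ebar * s ^ (((4 : ℝ) - d) / 2) →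
          P.mesh k * |C.e| * (CV * P.d * (P.mesh k * (c₁ * B2.pFn Q.b₀ Q.p (s / (L : ℝ)))) + CF * Real.exp (-(δ * ρ₁)) * (c₁ * (1 / (μ₀ * (s / (L : ℝ)))) * B2.pFn Q.b₀ Q.p (s / (L : ℝ)))) ≤ creg * ec →
      -- `x ∈ Bᵏ(ȳ)` with `ȳ` the centre of `□₁` and at least `m` inside `□₂` in every direction
      ∀ (x : HiggsLattice.Site P 0),
        (∀ ν : Fin P.d, m ≤ ((blockIter k x) ν - q ν).val ∧ ((blockIter k x) ν - q ν).val + m < Sbox) →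
        (∀ ν : Fin P.d, ((blockIter k x) ν - q₁ ν).val = R₁) →
      -- THE PRINTED RESTRICTIONS (2.55) on `Λ₋₁` for `A′, φ` and the background `A^{(k)}`: thresholds `c₁p(ℓ′)`, `c₁p(ℓ′)/(μ₀ℓ′)`, `c₁p(ℓ′)`, `c₁p(ℓ′)/λ(ℓ′)^{1/4}` at `ℓ′ = s/L`
      ∀ (φ : HiggsLattice.ScalarField P k N),
        Restr255Printed C c₁ Q.b₀ Q.p μ₀ lam (s / (L : ℝ)) k Λm1 A' φ (ofSite (cutMin C₀ mu0sq aV k ζ (toSite A'))) →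
        ‖bgScalar256 C msq a k Λ₂ Λ₆ (ofSite (cutMin C₀ mu0sq aV k ζ (toSite A'))) φ x
            - avgQkAdj C (ofSite (cutMin C₀ mu0sq aV k ζ (toSite A'))) k φ x‖
      -- print p.572 (2.65): «φ^{(k)}(x) = U(A^{(k)}(Γ^{(k)}_{x,y}))φ(y) + O(p(Lᵏε))»
          ≤ Cp * B2.pFn Q.b₀ Q.p s := by
  have hd4 : (0 : ℝ) < ((4 : ℝ) - d) / 4 := by
    have h3 : (d : ℝ) ≤ 3 := by exact_mod_cast hd3
    linarith
  obtain ⟨hκ₁, hκ₂⟩ := printed_exponents hd hd4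
  obtain ⟨δ, CV, CF, hδ, hCV, hCF, K₀min, h⟩ := eq265_higgs_region_remainder d L hd hd3 hL ha hmsq haV hmu0 N C ε₀ creg 1 hcreg
    one_pos Q hQ hc₁ hlam hθ₁ hθ₂ 0 (m₁ := m₁) hebar hθ₃ hκ₁ hκ₂
  refine ⟨δ, CV, CF, hδ, hCV, hCF, K₀min, fun K₀ hK₀ => ?_⟩
  obtain ⟨e₁, t, he₁, ht, C₁, C₂, C₃, D₁, D₂, D₃, D₄, -, -, -, -, -, -, -, C', hC', E₁, E₂, E₃, -, -, -, C'', C''', hC'', hC''', h⟩ :=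
    h K₀ hK₀
  have hb0 : 0 < Q.b₀ := hQ.2.2.2.2.2.2.1
  refine ⟨e₁, t, he₁, ht, C' * a / Q.b₀ + C'' + C''' / Q.b₀, by positivity, ?_⟩
  intro P S hPd hPL hK₀M k hk1 hkK h3 hε h1 Λ₂ Λ₆ sq₂ sq₁ Sfin q Sbox h62 hs2 h16 hΩΛ hbox hSbox hsq₂ h2S q₁ R₁ m hR₁m hRm hsq₁
    Λm1 ζ ρ ρ₁ hρ₁ zeta_abs zeta_supp zeta_one zeta_lip Rn hRn hRn2 hcube C₀ A' μ₀ hμ₀ s hs hs1 hθm hθR hS3 hm₁ ht' ec hec hle hecs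
    hsmall x hmargin hcentre φ h255
  have hmain := h P S hPd hPL hK₀M hk1 hkK h3 hε h1 Λ₂ Λ₆ sq₂ sq₁ Sfin q Sbox h62 hs2 h16 hΩΛ hbox hSbox hsq₂ h2S q₁ R₁ m hR₁m hRm hsq₁
    Λm1 ζ ρ ρ₁ hρ₁ zeta_abs zeta_supp zeta_one zeta_lip Rn hRn hRn2 hcube C₀ A' hμ₀ hs hs1 hθm hθR hS3 hm₁ ht' hec hle hecs
    (by rwa [Real.rpow_one]) x hmargin hcentre φ h255
  have hLP : 1 < (P.L : ℝ) := by rw [hPL]; exact_mod_cast hL.2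
  exact hmain.trans (absorb_three_groups hC' hC''' ha.le (B1.aSeq_le ha hLP k hk1) hb0 (lt_trans two_pos hQ.1).le hs hs1)

/-! ## §2 Print's own tower regions, cube size `M` -/

/-- **LEMMA 2.4 (2.65) IN PRINT'S LITERAL SHAPE ON PRINT'S OWN REGIONS `Λ₂^{(k−1)′} ⊇ Λ₆^{(k−1)′}`, `Λ₋₁^{(k−1)′} ⊇ (near Λ₀^{(k−1)} r)′`.**
TYPED vs PRINTED: own F21 `B2Eq265PrintedRemainder.eq265_higgs_tower_remainder` at `β := 1`, `κ := 0`, `κ₀ := 0` with the located edits of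
the header (level `j + 1`, cube size `M`); `rad`, `bad` data; nothing minted. [cite: Balaban1982Higgs2, Lemma 2.4 (2.65) p.572, (2.2)/(2.5) p.557, (2.7)–(2.8) p.558, (2.43) p.566, (2.55)–(2.56) p.570, (2.60) p.571]
[cite: Balaban1982Higgs1, Prop. 2.1 p.610 «let Ω^{(k)} ⊂ T^{(k)}_1 be a sum of big blocks with M sufficiently large», (2.15) p.609] -/
theorem eq265_higgs_tower_asPrinted (d L : ℕ) (hd : 1 ≤ d) (hd3 : d ≤ 3) (hL : Odd L ∧ 1 < L) {a : ℝ} (ha : 0 < a) {msq : ℝ} (hmsq : 0 < msq)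
    {aV : ℝ} (haV : 0 < aV) {mu0sq : ℝ} (hmu0 : 0 < mu0sq)
    (N : ℕ) (C : ChargeData N) (ε₀ : ℝ) (creg : ℝ) (hcreg : 0 ≤ creg)
    (Q : B2.Params) (hQ : Q.Printed) {c₁ lam : ℝ} (hc₁ : 0 ≤ c₁) (hlam : 0 < lam) {θ₁ θ₂ : ℝ} (hθ₁ : 0 < θ₁) (hθ₂ : 0 < θ₂)
    {ebar θ₃ m₁ : ℝ} (hebar : 0 ≤ ebar) (hθ₃ : 0 ≤ θ₃) :
    ∃ δ CV CF : ℝ, 0 < δ ∧ 0 < CV ∧ 0 < CF ∧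
    ∃ Mmin : ℕ, ∀ M : ℕ, Mmin ≤ M → ∃ e₁ t : ℝ, 0 < e₁ ∧ 0 < t ∧
      ∃ Cp : ℝ, 0 ≤ Cp ∧
      ∀ (P : HiggsLattice.Params) (_ : Shape P), P.d = d → P.L = L → P.M = M →
      ∀ {j : ℕ}, j + 1 ≤ P.K → (∀ μ, 3 * half P (j + 1) M ≤ P.sitesPerDir 0 μ) → P.mesh (j + 1) ≤ ε₀ → P.mesh (j + 1) ≤ 1 →
      -- PRINT'S OWN REGIONS: the (2.7)–(2.8)/(2.43) tower of step `j`, primed to `T^{(k)}`, `k = j + 1`; `Λ₂′ ⊇ □₂`, `Λ₆′ ⊇ □₁`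
      ∀ (bad : (l : ℕ) → Set (HiggsLattice.Site P l)) (rad : ℕ → ℝ), 0 < rad j →
      ∀ (sq₂ sq₁ : Finset (HiggsLattice.Site P (j + 1))) (S : Fin P.d → Finset ℕ) (q : HiggsLattice.Site P (j + 1)) (Sbox : ℕ),
        sq₂ ⊆ prime (towerRegion bad rad j 2) → sq₁ ⊆ prime (towerRegion bad rad j 6) →
        underRegion (j + 1) sq₂ = cellBox (j + 1) M S →
        (∀ μ : Fin P.d, P.L ^ (j + 1) * Sbox < P.sitesPerDir 0 μ) →
      -- `□₂` IS the box `q + [0,S)ᵈ` of coarse sites, `□ = B^k(□₂)` smaller than half the torus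
        (∀ y : HiggsLattice.Site P (j + 1), y ∈ sq₂ ↔ ∀ ν : Fin P.d, (y ν - q ν).val < Sbox) →
        (∀ μ : Fin P.d, 2 * (P.L ^ (j + 1) * Sbox) ≤ P.sitesPerDir 0 μ) →
      -- `□₁` is the box of coarse sites of radius `R₁` (corner `q₁`); `m ≥ R₁` a coarse margin with `Lᵏm ≥` the depth radius
      ∀ (q₁ : HiggsLattice.Site P (j + 1)) (R₁ m : ℕ), R₁ ≤ m → 2 * rS P (j + 1) M + 2 * half P (j + 1) M * (P.d + 1) + 1 ≤ P.L ^ (j + 1) * m →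
        (∀ y : HiggsLattice.Site P (j + 1), y ∈ sq₁ ↔ ∀ ν : Fin P.d, (y ν - q₁ ν).val < 2 * R₁ + 1) →
      -- the cutoff `ζ^{(k)}` of (2.44)
      ∀ (ζ : HiggsLattice.Site P 0 → HiggsLattice.Site P (j + 1) → ℝ) (ρ ρ₁ : ℝ), 0 ≤ ρ₁ →
        (∀ x y', |ζ x y'| ≤ 1) →
        (∀ x y', ζ x y' ≠ 0 → (HiggsLattice.Site.tdist (blockIter (j + 1) x) y' : ℝ) ≤ ρ) →
        (∀ x y', (HiggsLattice.Site.tdist (blockIter (j + 1) x) y' : ℝ) ≤ ρ₁ → ζ x y' = 1) →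
        (∀ (x : HiggsLattice.Site P 0) (ν : Fin P.d) (y' : HiggsLattice.Site P (j + 1)), |ζ (x.shift ν) y' - ζ x y'| ≤ ((P.L : ℝ) ^ (j + 1))⁻¹) →
      -- the cube of radius `R_n ≥ ρ + 1` about `y ∈ Λ₂′` lies in `Λ₋₁′ := (near Λ₀^{(j)} r(Lʲε))′` once `L(R_n + 1) − 1 ≤ 3n`, `n < r(Lʲε)` ((2.8) collars)
      ∀ (Rn : ℕ), ρ + 1 ≤ (Rn : ℝ) → (∀ μ : Fin P.d, 2 * (2 * Rn + 1) ≤ P.sitesPerDir (j + 1) μ) →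
      ∀ (n : ℕ), (n : ℝ) < rad j → (P.L : ℝ) * ((Rn : ℝ) + 1) - 1 ≤ 3 * (n : ℝ) →
      -- a charge datum on `ℝ^d`, the step's vector field `A′`, and print's `μ₀` of the (2.55)₂ threshold
      ∀ (C₀ : ChargeData P.d) (A' : HiggsLattice.VecField P (j + 1)) {μ₀ : ℝ}, 0 < μ₀ →
      -- THE PHYSICAL SCALE `s ⇐ Lᵏε` AS A FREE LETTER (F18a), the (2.55) letter `L^{k−1}ε ⇐ s/L`: radii readings `m ≥ θ₁r(s)`, `R₁ + 1 ≥ θ₂r(s)`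
      ∀ {s : ℝ}, 0 < s → s ≤ 1 →
        θ₁ * B2.rFn Q.R Q.r s ≤ (m : ℝ) → θ₂ * B2.rFn Q.R Q.r s ≤ (R₁ : ℝ) + 1 →
      -- THE DICTIONARY READ at `s ⇐ Lᵏε`: the side of `□₂` `S ≤ θ₃r(s)` (p.572, (2.7)), the mass term `m²ℓ² ≤ m₁²s²` ((2.1)); below: `e_c ≤ ē·s^{(4−d)/2}` ((2.5))
        (Sbox : ℝ) ≤ θ₃ * B2.rFn Q.R Q.r s → msq * P.mesh (j + 1) ^ 2 ≤ m₁ ^ 2 * s ^ 2 →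
      -- `δ_A :=` THE (2.60) BOUND ITSELF (read off the printed (2.55)₁,₂ thresholds at `ℓ′ = s/L`), small in the two printed scalings: `Lᵏδ_A|e| ≤ t`, `Lᵏℓ|e|δ_A ≤ c_reg·e_c` (`β = 1`)
        (CV * P.d * (P.mesh (j + 1) * (c₁ * B2.pFn Q.b₀ Q.p (s / (L : ℝ)))) + CF * Real.exp (-(δ * ρ₁)) * (c₁ * (1 / (μ₀ * (s / (L : ℝ)))) * B2.pFn Q.b₀ Q.p (s / (L : ℝ)))) * |C.e| ≤ t →
        ∀ {ec : ℝ}, 0 < ec → ec ≤ e₁ → ec ≤ ebar * s ^ (((4 : ℝ) - d) / 2) →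
          P.mesh (j + 1) * |C.e| * (CV * P.d * (P.mesh (j + 1) * (c₁ * B2.pFn Q.b₀ Q.p (s / (L : ℝ)))) + CF * Real.exp (-(δ * ρ₁)) * (c₁ * (1 / (μ₀ * (s / (L : ℝ)))) * B2.pFn Q.b₀ Q.p (s / (L : ℝ)))) ≤ creg * ec →
      -- `x ∈ Bᵏ(ȳ)` with `ȳ` the centre of `□₁` and at least `m` inside `□₂` in every direction
      ∀ (x : HiggsLattice.Site P 0),
        (∀ ν : Fin P.d, m ≤ ((blockIter (j + 1) x) ν - q ν).val ∧ ((blockIter (j + 1) x) ν - q ν).val + m < Sbox) →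
        (∀ ν : Fin P.d, ((blockIter (j + 1) x) ν - q₁ ν).val = R₁) →
      -- THE PRINTED RESTRICTIONS (2.55) on `Λ₋₁` for `A′, φ` and the background `A^{(k)}`: thresholds `c₁p(ℓ′)`, `c₁p(ℓ′)/(μ₀ℓ′)`, `c₁p(ℓ′)`, `c₁p(ℓ′)/λ(ℓ′)^{1/4}` at `ℓ′ = s/L`
      ∀ (φ : HiggsLattice.ScalarField P (j + 1) N),
        Restr255Printed C c₁ Q.b₀ Q.p μ₀ lam (s / (L : ℝ)) (j + 1) (prime (near (towerRegion bad rad j 0) (rad j))) A' φ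
          (ofSite (cutMin C₀ mu0sq aV (j + 1) ζ (toSite A'))) →
        ‖bgScalar256 C msq a (j + 1) (prime (towerRegion bad rad j 2)) (prime (towerRegion bad rad j 6))
              (ofSite (cutMin C₀ mu0sq aV (j + 1) ζ (toSite A'))) φ x
            - avgQkAdj C (ofSite (cutMin C₀ mu0sq aV (j + 1) ζ (toSite A'))) (j + 1) φ x‖
      -- print p.572 (2.65): «φ^{(k)}(x) = U(A^{(k)}(Γ^{(k)}_{x,y}))φ(y) + O(p(Lᵏε))»
          ≤ Cp * B2.pFn Q.b₀ Q.p s := by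
  have hd4 : (0 : ℝ) < ((4 : ℝ) - d) / 4 := by
    have h3 : (d : ℝ) ≤ 3 := by exact_mod_cast hd3
    linarith
  obtain ⟨hκ₁, hκ₂⟩ := printed_exponents hd hd4
  obtain ⟨δ, CV, CF, hδ, hCV, hCF, Mmin, h⟩ := eq265_higgs_tower_remainder d L hd hd3 hL ha hmsq haV hmu0 N C ε₀ creg 1 hcreg
    one_pos Q hQ hc₁ hlam hθ₁ hθ₂ 0 (m₁ := m₁) hebar hθ₃ hκ₁ hκ₂
  refine ⟨δ, CV, CF, hδ, hCV, hCF, Mmin, fun M hM => ?_⟩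
  obtain ⟨e₁, t, he₁, ht, C₁, C₂, C₃, D₁, D₂, D₃, D₄, -, -, -, -, -, -, -, C', hC', E₁, E₂, E₃, -, -, -, C'', C''', hC'', hC''', h⟩ :=
    h M hM
  have hb0 : 0 < Q.b₀ := hQ.2.2.2.2.2.2.1
  refine ⟨e₁, t, he₁, ht, C' * a / Q.b₀ + C'' + C''' / Q.b₀, by positivity, ?_⟩
  intro P S hPd hPL hPM j hjK h3 hε h1 bad rad hrad sq₂ sq₁ Sfin q Sbox hs2 h16 hbox hSbox hsq₂ h2S q₁ R₁ m hR₁m hRm hsq₁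
    ζ ρ ρ₁ hρ₁ zeta_abs zeta_supp zeta_one zeta_lip Rn hRn hRn2 n hn hroom C₀ A' μ₀ hμ₀ s hs hs1 hθm hθR hS3 hm₁ ht' ec hec hle hecs
    hsmall x hmargin hcentre φ h255
  have hmain := h P S hPd hPL hPM hjK h3 hε h1 bad rad hrad sq₂ sq₁ Sfin q Sbox hs2 h16 hbox hSbox hsq₂ h2S q₁ R₁ m hR₁m hRm hsq₁
    ζ ρ ρ₁ hρ₁ zeta_abs zeta_supp zeta_one zeta_lip Rn hRn hRn2 n hn hroom C₀ A' hμ₀ hs hs1 hθm hθR hS3 hm₁ ht' hec hle hecs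
    (by rwa [Real.rpow_one]) x hmargin hcentre φ h255
  have hLP : 1 < (P.L : ℝ) := by rw [hPL]; exact_mod_cast hL.2
  exact hmain.trans (absorb_three_groups hC' hC''' ha.le (B1.aSeq_le ha hLP (j + 1) (Nat.succ_le_succ (Nat.zero_le j))) hb0
    (lt_trans two_pos hQ.1).le hs hs1)

end Literature.MathematicalPhysics.QuantumFieldTheory.Balaban1983to89.B2Eq265AsPrinted

end
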